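import Literature.Geometry.Lorentzian.MetricFlattening
import Literature.Geometry.Lorentzian.EnergyCurrents
import Literature.Topology.FourManifolds.SurfaceMorseCountLeTwo
import Mathlib.Analysis.Calculus.BumpFunction.FiniteDimension
import HarnessLib

/-!
# Preparations for the Gauss–Bonnet inequality: flat metrics near finitely many points,
# cutoff profiles, non-vanishing gradients, and the signed count of Morse critical points

Auxiliary results (all proved) for `GaussBonnetInequality.lean` (the bound `∫_S R dμ ≤ 8π` for a
closed connected Riemannian surface, Huisken–Ilmanen 2001, §5, via the intrinsic proof of the
Gauss–Bonnet theorem, Chern 1944, §2, and the Morse count, Milnor 1963/1965):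

* `exists_flat_metric` — given finitely many charts `e_p` of the maximal atlas and cutoffs `χ_p`
  with pairwise disjoint supports in the chart domains, there is a smooth Riemannian metric `h'`
  which agrees with `h` off the supports and equals `e_p^* δ` where `χ_p = 1` (iterated
  `MetricFlattening.flatten`);
* `exists_smooth_profile` — a smooth `[0,1]`-valued profile `= 1` on `B̄(0,a)`, supported in
  `B(0,b)`;
* `mvfderiv_eq_zero_iff`, `gradSq_ne_zero_of_mfderiv_ne_zero` — a Riemannian gradient square
  vanishes exactly at critical points;
* `sum_neg_one_pow_morseIndex_le_two` — for a Morse function on a closed connected surface,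
  `Σ_{p critical} (−1)^{index p} = #Crit₀ − #Crit₁ + #Crit₂ ≤ 2`
  (`morseCount_surface_le_two`).

## References

* S.-S. Chern, *A simple intrinsic proof of the Gauss–Bonnet formula…*, Ann. of Math. 45 (1944),
  §2. [Chern1944]
* J. Milnor, *Lectures on the h-cobordism theorem* (1965), §3. [MilnorHCobordism1965]
-/

noncomputable section

set_option maxSynthPendingDepth 3

open Bundle Set Function Filter Module TopologicalSpace Manifold Metric
open scoped Manifold ContDiff Topology

namespace Literature.Geometry.Lorentzian

open Literature.Geometry.Riemannian Literature.Topology.FourManifolds PseudoRiemannianMetric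

/-! ### Smooth profiles -/

/-- **A smooth cutoff profile**: for `0 < a < b` there is a `C^∞` function `φ : E → [0, 1]` with
`φ = 1` on the closed ball `B̄(0, a)`, `tsupport φ` compact and contained in the open ball
`B(0, b)`, in particular `φ 0 = 1` (Mathlib's `ContDiffBump` with radii `a < (a + b)/2`).
[folklore] -/
theorem exists_smooth_profile {E : Type*} [NormedAddCommGroup E] [NormedSpace ℝ E]
    [FiniteDimensional ℝ E] {a b : ℝ} (ha : 0 < a) (hab : a < b) :
    ∃ φ : E → ℝ, ContDiff ℝ ∞ φ ∧ (∀ x, φ x ∈ Icc (0 : ℝ) 1) ∧ (∀ x ∈ closedBall (0 : E) a, φ x = 1) ∧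
      IsCompact (tsupport φ) ∧ tsupport φ ⊆ ball (0 : E) b ∧ φ 0 = 1 := by
  haveI : HasContDiffBump E := inferInstance
  let f : ContDiffBump (0 : E) := ⟨a, (a + b) / 2, ha, by linarith⟩
  refine ⟨f, f.contDiff, fun x ↦ ⟨f.nonneg, f.le_one⟩, fun x hx ↦ f.one_of_mem_closedBall hx,
    f.hasCompactSupport, ?_, ?_⟩
  · rw [f.tsupport_eq]
    exact closedBall_subset_ball (by show (a + b) / 2 < b; linarith)
  · exact f.one_of_mem_closedBall (mem_closedBall_self ha.le)

/-! ### Gradients vanish exactly at critical points -/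

section Gradient

variable {E : Type*} [NormedAddCommGroup E] [NormedSpace ℝ E] {H : Type*} [TopologicalSpace H]
  {I : ModelWithCorners ℝ E H} {M : Type*} [TopologicalSpace M] [ChartedSpace H M]

/-- `mvfderiv f x = 0 ↔ mfderiv f x = 0` (`mvfderiv` is `mfderiv` composed with the canonical
identification of the tangent space of `ℝ`). [folklore] -/
theorem mvfderiv_eq_zero_iff {f : M → ℝ} {x : M} :
    mvfderiv I f x = 0 ↔ mfderiv I 𝓘(ℝ, ℝ) f x = 0 := by
  constructor
  · intro h
    have h' : ∀ v, mvfderiv I f x v = 0 := fun v ↦ by rw [h]; rfl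
    ext v
    have := h' v
    simp only [mvfderiv, ContinuousLinearMap.comp_apply] at this
    exact (ContinuousLinearEquiv.map_eq_zero_iff _).1 this
  · intro h
    ext v
    simp [mvfderiv, h]

variable [IsManifold I ∞ M] [FiniteDimensional ℝ E]
  (h : ContMDiffRiemannianMetric I ∞ E (TangentSpace I : M → Type _))

/-- **For a Riemannian metric `|∇f|²(x) ≠ 0` at a non-critical point** (`g⁻¹(df, df) = g(♯df, ♯df)`
is positive for `df ≠ 0`). [cite: ONeill1983, Ch. 3, p. 85] -/
theorem gradSq_ne_zero_of_mfderiv_ne_zero {f : M → ℝ} {x : M} (hx : mfderiv I 𝓘(ℝ, ℝ) f x ≠ 0) :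
    (ofRiemannian h).gradSq f x ≠ 0 := by
  have hne : mvfderiv I f x ≠ 0 := fun h0 ↦ hx (mvfderiv_eq_zero_iff.1 h0)
  have hα : (mvfderiv I f x : TangentSpace I x →ₗ[ℝ] ℝ) ≠ 0 := by
    intro h0
    apply hne
    ext v
    exact LinearMap.congr_fun h0 v
  have hsharp : (ofRiemannian h).sharp x (mvfderiv I f x : TangentSpace I x →ₗ[ℝ] ℝ) ≠ 0 := by
    intro h0
    exact hα ((LinearEquiv.map_eq_zero_iff _).1 h0)
  rw [gradSq, innerDual_eq_val_sharp_sharp]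
  exact (isRiemannian_ofRiemannian h x _ hsharp).ne'

end Gradient

/-! ### Flattening near finitely many points -/

section Flatten

variable {Em : Type*} [NormedAddCommGroup Em] [InnerProductSpace ℝ Em] [FiniteDimensional ℝ Em]
  {N : Type*} [TopologicalSpace N] [ChartedSpace Em N] [IsManifold 𝓘(ℝ, Em) ∞ N]
  (h : ContMDiffRiemannianMetric 𝓘(ℝ, Em) ∞ Em (TangentSpace 𝓘(ℝ, Em) : N → Type _))

/-- **A metric flat near finitely many points.** Given finitely many charts `e p` of the maximal
atlas and smooth cutoffs `χ p : N → [0,1]` with `tsupport (χ p) ⊆ (e p).source` and pairwise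
disjoint supports (`p ∈ C`), there is a smooth Riemannian metric `h'` with `h' = h` off
`⋃ tsupport (χ p)` and `h' = (e p)^* δ` wherever `χ p = 1` — obtained by applying
`MetricFlattening.flatten` once for each `p ∈ C` (the modifications have disjoint supports, so
each flattened region is untouched by the later steps). [cite: Chern1944, §2] -/
theorem exists_flat_metric (C : Finset N) (e : N → OpenPartialHomeomorph N Em)
    (he : ∀ p ∈ C, e p ∈ IsManifold.maximalAtlas 𝓘(ℝ, Em) ∞ N) (χ : N → N → ℝ)
    (hχs : ∀ p ∈ C, ContMDiff 𝓘(ℝ, Em) 𝓘(ℝ, ℝ) ∞ (χ p)) (hχ01 : ∀ p ∈ C, ∀ x, χ p x ∈ Icc (0 : ℝ) 1)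
    (hχe : ∀ p ∈ C, tsupport (χ p) ⊆ (e p).source)
    (hdisj : ∀ p ∈ C, ∀ q ∈ C, p ≠ q → Disjoint (tsupport (χ p)) (tsupport (χ q))) :
    ∃ h' : ContMDiffRiemannianMetric 𝓘(ℝ, Em) ∞ Em (TangentSpace 𝓘(ℝ, Em) : N → Type _),
      (∀ x, (∀ p ∈ C, x ∉ tsupport (χ p)) → h'.inner x = h.inner x) ∧
      (∀ p ∈ C, ∀ x, χ p x = 1 → ∀ v w, h'.inner x v w =
        (euclideanMetric Em).val (e p x) (mfderiv 𝓘(ℝ, Em) 𝓘(ℝ, Em) (e p) x v)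
          (mfderiv 𝓘(ℝ, Em) 𝓘(ℝ, Em) (e p) x w)) := by
  classical
  induction C using Finset.induction_on with
  | empty => exact ⟨h, fun x _ ↦ rfl, fun p hp ↦ absurd hp (Finset.notMem_empty p)⟩
  | insert q C hq ih =>
    obtain ⟨h₁, h₁off, h₁flat⟩ := ih (fun p hp ↦ he p (Finset.mem_insert_of_mem hp))
      (fun p hp ↦ hχs p (Finset.mem_insert_of_mem hp)) (fun p hp ↦ hχ01 p (Finset.mem_insert_of_mem hp))
      (fun p hp ↦ hχe p (Finset.mem_insert_of_mem hp))
      (fun p hp p' hp' hne ↦ hdisj p (Finset.mem_insert_of_mem hp) p' (Finset.mem_insert_of_mem hp') hne)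
    have hqC : q ∈ insert q C := Finset.mem_insert_self q C
    let h₂ := flatten h₁ (he q hqC) (hχs q hqC) (hχ01 q hqC) (hχe q hqC)
    refine ⟨h₂, fun x hx ↦ ?_, fun p hp x hx v w ↦ ?_⟩
    · rw [flatten_inner_of_notMem_tsupport h₁ (he q hqC) (hχs q hqC) (hχ01 q hqC) (hχe q hqC)
        (hx q hqC)]
      exact h₁off x fun p hp ↦ hx p (Finset.mem_insert_of_mem hp)
    · rcases Finset.mem_insert.1 hp with rfl | hpC
      · exact flatten_inner_of_eq_one h₁ (he p hqC) (hχs p hqC) (hχ01 p hqC) (hχe p hqC) hx v w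
      · have hpq : p ≠ q := fun hpq ↦ hq (hpq ▸ hpC)
        have hxp : x ∈ tsupport (χ p) := subset_tsupport _ (by simp [hx])
        have hxq : x ∉ tsupport (χ q) := fun hxq ↦
          (hdisj p hp q hqC hpq).le_bot ⟨hxp, hxq⟩
        have h2 : h₂.inner x = h₁.inner x :=
          flatten_inner_of_notMem_tsupport h₁ (he q hqC) (hχs q hqC) (hχ01 q hqC) (hχe q hqC) hxq
        rw [show h₂.inner x v w = h₁.inner x v w by rw [h2]]
        exact h₁flat p hpC x hx v w

end Flatten

/-! ### The signed count of the critical points of a Morse function on a closed surface -/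

section Count

variable {S : Type*} [TopologicalSpace S] [T2Space S] [SecondCountableTopology S] [CompactSpace S]
  [ConnectedSpace S] [ChartedSpace (EuclideanSpace ℝ (Fin 2)) S] [IsManifold (𝓡 2) ∞ S]

/-- **`Σ_{p critical} (−1)^{index p} ≤ 2` for a Morse function on a closed connected surface**:
grouping the (finitely many) critical points by their index `0, 1, 2` gives
`#Crit₀ − #Crit₁ + #Crit₂`, which is at most `2` (`morseCount_surface_le_two`, Milnor 1965, §3
with `χ(S) ≤ 2`). [cite: MilnorHCobordism1965, §3 (PDF p. 21)] -/
theorem sum_neg_one_pow_morseIndex_le_two {f : S → ℝ} (hf : IsMorse (𝓡 2) f)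
    (hfin : (criticalSet (𝓡 2) f).Finite) :
    ∑ p ∈ hfin.toFinset, (-1 : ℝ) ^ morseIndex (𝓡 2) f p ≤ 2 := by
  classical
  have hle := morseCount_surface_le_two hf
  -- group by index
  have hidx : ∀ p ∈ hfin.toFinset, morseIndex (𝓡 2) f p ∈ Finset.range 3 := by
    intro p _
    have h := morseIndex_le_finrank (𝓡 2) f p
    simp only [finrank_euclideanSpace_fin] at h
    exact Finset.mem_range.2 (by omega)
  rw [← Finset.sum_fiberwise_of_maps_to hidx]
  have hfib : ∀ k, ∑ p ∈ hfin.toFinset with morseIndex (𝓡 2) f p = k, (-1 : ℝ) ^ morseIndex (𝓡 2) f p =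
      (-1 : ℝ) ^ k * (criticalSetOfIndex (𝓡 2) f k).ncard := by
    intro k
    have hset : (criticalSetOfIndex (𝓡 2) f k : Set S) =
        ↑(hfin.toFinset.filter fun p ↦ morseIndex (𝓡 2) f p = k) := by
      ext z
      simp only [mem_criticalSetOfIndex, Finset.coe_filter, Set.Finite.mem_toFinset, mem_criticalSet,
        mem_setOf_eq]
    rw [hset, Set.ncard_coe_finset, Finset.sum_congr rfl fun p hp ↦ by rw [(Finset.mem_filter.1 hp).2],
      Finset.sum_const, nsmul_eq_mul, mul_comm]
  simp only [hfib, Finset.sum_range_succ, Finset.sum_range_zero, zero_add, pow_zero, one_mul, pow_one,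
    neg_one_mul, even_two, Even.neg_pow, one_pow]
  have hcast : ((criticalSetOfIndex (𝓡 2) f 0).ncard : ℝ) - (criticalSetOfIndex (𝓡 2) f 1).ncard
      + (criticalSetOfIndex (𝓡 2) f 2).ncard ≤ 2 := by exact_mod_cast hle
  linarith

end Count

end Literature.Geometry.Lorentzian

end
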